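import Mathlib
import Literature.AlgebraicGeometry.Resolution.CobordantGame
import Literature.AlgebraicGeometry.Resolution.CobordantArcLemma
import Literature.AlgebraicGeometry.Resolution.CobordantArcPersistence
import Literature.AlgebraicGeometry.Resolution.CobordantVertexChart
import Literature.AlgebraicGeometry.Resolution.CobordantChartCoefficients
import Literature.AlgebraicGeometry.Resolution.FormalCoordinateChange
import Literature.AlgebraicGeometry.Resolution.FormalInverseFunction
import Summits.ResolutionOfSingularities.ResolutionOfSingularities.Theorems.WeightedInvariantLocalWeightedDropGradedSliceRank
import Summits.ResolutionOfSingularities.ResolutionOfSingularities.Theorems.WeightedInvariantLocalWeightedDropGradedGameCoordChange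

/-!
# `WeightedInvariant.LocalWeightedDrop`: the CYLINDER over the arc-lemma witness, `x² + y³z² ∈ k[[x, z, t, y]]`, has no
# one-move win — in any formal coordinates, for any grading lattice

Route `ResolutionOfSingularities/WeightedInvariant`, crux `LocalWeightedDrop` (stmt-ResolutionOfSingularities-8899).
[OURS · L1 W4.3] — res-type-099 (gen 13) as res-type-060's kernel co-hand on the WILD SLICE CLAUSE of the graded-slice line
(res-L1-w43-plan-1 DEALS gen 9 #23; ideator res-L1-w43-idea-1, Sketch-L1-idea-1 v4 §5, one-sided slice statement T3″ «slice
graded-won with rank `α` ⇒ successor graded-won with rank `α`», tame half PROVED by res-type-060 as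
`GradedGame.gradedWonBy_of_slice_tame`, p515424).  This file is the NEGATIVE ENGINE of the wild-slice specimen of the companion
module `WeightedInvariantLocalWeightedDropGradedSliceWildProbes`: the four-variable germ

  `W₄ = x₀² + x₃³·x₁²`  (the arc-lemma witness `x² + y³z²` of `Literature…CobordantArc.witness` with a cylinder direction `x₂`)

admits NO legal move of the local weighted resolution game all of whose exceptional points off the vertex have a non-singular
`s`-saturated successor (`subst_witness4_has_singular_successor`), whatever formal coordinate change `θ` the Prover applies first;
hence `¬ GradedWonBy 0 4 L (W₄(Φ))` for every lattice `L` and every coordinate change `Φ` (`not_gradedWonBy_zero_subst_witness4`).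
Four-variable transcription of `CobordantArc.witness_has_singular_successor` (`CobordantArcLemma`): the singular locus of `W₄`
contains the coordinate axes `e₁, e₂, e₃`; for a centre of codimension `≥ 2` a transported coordinate arc leaves the centre (two
rows of an invertible matrix cannot both be multiples of `e₀ᵀ`) and the ARC LEMMA gives an exceptional point off the vertex with
SINGULAR `s`-saturated successor; for a divisorial centre `x_{i₀} ∤ W₄(θ)` (order parity `2n₀ = 3n₃ + 2n₁`).  Nothing here is a
statement of the manuscript under review on ladder RESOLUTION; no claim about card A.  AI proof, weaker than expert review.

* `coeff_one_subst_single_X`, `not_two_rows_supported_single'`, `coeff_single_subst_update_zero` — `m`-variable forms of the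
  `Fin 3` bookkeeping lemmas of `CobordantArcLemma`; `subst_arc_witness4_eq_zero` — `W₄` and its partials die along arcs with
  `γ₀ = 0`, `γ₁ = 0 ∨ γ₃ = 0`; `exists_singleArc_not_in_centre4` (codimension `≥ 2`); `not_X_dvd_subst_witness4` (divisorial).
* `subst_witness4_has_singular_successor` — the game-form negative theorem (every field).
* `not_gradedWonBy_zero_subst_witness4` — no graded one-move win for `W₄(Φ)`, any lattice, any coordinate change `Φ`.
-/

set_option linter.dupNamespace false -- mandated namespace of this single-conjunct summit
set_option autoImplicit false

namespace Summit.ResolutionOfSingularities.ResolutionOfSingularities.Theorems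

namespace GradedGame

open MvPowerSeries
open Literature.AlgebraicGeometry.Resolution
open Literature.AlgebraicGeometry.Resolution.CobordantChart (chart subst_chart_ne_zero)
open Literature.AlgebraicGeometry.Resolution.CobordantArc (exists_offVertex_singular_of_arc coeff_degree_one_subst
  linMat_mul_of_comp_eq_X constantCoeff_subst_arc_zero subst_arc_comp subst_arc_pd_comp constantCoeff_chart
  X_dvd_subst_chart_divisorial_iff pd_sq pd_cube)
open Literature.AlgebraicGeometry.Resolution.FormalCoordChange (linMat exists_comp_inverse two_le_order_iff
  two_le_order_subst subst_ne_zero_of_isUnit_det)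
open Literature.RingTheory.MvPowerSeries (pd pd_mul pd_X)

variable {k : Type} [Field k]

/-! ## §1 Bookkeeping in `m` variables -/

/-- The linear coefficient of `ψᵢ` along the coordinate arc `t·e_a` (`Pi.single a X`) is the `(i,a)` entry of the linear part of
`ψ`. [OURS · L1 W4.3] -/
theorem coeff_one_subst_single_X {m : ℕ} (ψ : Fin m → MvPowerSeries (Fin m) k) (a i : Fin m) :
    PowerSeries.coeff 1 (subst (Pi.single a PowerSeries.X : Fin m → PowerSeries k) (ψ i) : PowerSeries k) =
      coeff (Finsupp.single a 1) (ψ i) := by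
  classical
  have h0 : ∀ j, PowerSeries.constantCoeff ((Pi.single a PowerSeries.X : Fin m → PowerSeries k) j) = 0 := by
    intro j
    by_cases hj : j = a
    · subst hj; simp
    · simp [hj]
  change MvPowerSeries.coeff (Finsupp.single () 1) _ = _
  rw [coeff_degree_one_subst (Pi.single a PowerSeries.X) h0 (ψ i) _ (Finsupp.degree_single _ _), Finset.sum_eq_single a]
  · rw [Pi.single_eq_same]
    change _ * PowerSeries.coeff 1 PowerSeries.X = _
    rw [PowerSeries.coeff_one_X, mul_one]
  · intro j _ hja
    rw [Pi.single_eq_of_ne hja, map_zero, mul_zero]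
  · simp

/-- Two rows of an invertible square matrix cannot both be multiples of the same `e_{i₀}ᵀ`. [OURS · L1 W4.3] -/
theorem not_two_rows_supported_single' {m : ℕ} {L : Matrix (Fin m) (Fin m) k} (hdet : IsUnit L.det)
    (i₀ s s' : Fin m) (hss : s ≠ s') (hs : ∀ j, j ≠ i₀ → L s j = 0) (hs' : ∀ j, j ≠ i₀ → L s' j = 0) : False := by
  classical
  apply hdet.ne_zero
  by_cases hz : L s i₀ = 0
  · exact Matrix.det_eq_zero_of_row_eq_zero s fun j => by
      by_cases hj : j = i₀
      · subst hj; exact hz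
      · exact hs j hj
  · rw [← Matrix.exists_vecMul_eq_zero_iff]
    refine ⟨L s' i₀ • Pi.single s 1 - L s i₀ • Pi.single s' 1, ?_, ?_⟩
    · intro hv
      have := congrFun hv s'
      simp [hss.symm] at this
      exact hz this
    · rw [Matrix.sub_vecMul, Matrix.smul_vecMul, Matrix.smul_vecMul, Matrix.single_one_vecMul,
        Matrix.single_one_vecMul]
      ext j
      simp only [Pi.sub_apply, Pi.smul_apply, smul_eq_mul, Pi.zero_apply, Matrix.row_apply]
      by_cases hj : j = i₀
      · subst hj; ring
      · rw [hs j hj, hs' j hj]; ring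

/-- Linear coefficients after killing the coordinate `x_{i₀}` (substituting `0` for it): the row of the linear part with the
column `i₀` deleted. [OURS · L1 W4.3] -/
theorem coeff_single_subst_update_zero {m : ℕ} (θ : Fin m → MvPowerSeries (Fin m) k) (i₀ s j : Fin m) :
    coeff (Finsupp.single j 1) (subst (fun l : Fin m => if l = i₀ then (0 : MvPowerSeries (Fin m) k) else X l) (θ s)) =
      if j = i₀ then 0 else coeff (Finsupp.single j 1) (θ s) := by
  classical
  have h0 : ∀ l, constantCoeff ((fun l : Fin m => if l = i₀ then (0 : MvPowerSeries (Fin m) k) else X l) l) = 0 := by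
    intro l
    by_cases hl : l = i₀
    · simp [hl]
    · simp [hl, constantCoeff_X]
  rw [coeff_degree_one_subst _ h0 (θ s) _ (Finsupp.degree_single _ _)]
  split_ifs with hj
  · subst hj
    apply Finset.sum_eq_zero
    intro l _
    by_cases hl : l = j
    · simp [hl]
    · simp only [if_neg hl]
      rw [coeff_X, if_neg, mul_zero]
      intro h; exact hl ((Finsupp.single_left_inj one_ne_zero).mp h).symm
  · rw [Finset.sum_eq_single j]
    · simp only [if_neg hj]
      rw [coeff_X, if_pos rfl, mul_one]
    · intro l _ hlj
      by_cases hl : l = i₀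
      · simp [hl]
      · simp only [if_neg hl]
        rw [coeff_X, if_neg, mul_zero]
        intro h; exact hlj ((Finsupp.single_left_inj one_ne_zero).mp h).symm
    · simp

/-! ## §2 The germ `W₄ = x₀² + x₃³·x₁²` -/

/-- `W₄ ≠ 0` (the coefficient of `x₀²` is `1`). [OURS · L1 W4.3] -/
theorem witness4_ne_zero : (X 0 ^ 2 + X 3 ^ 3 * X 1 ^ 2 : MvPowerSeries (Fin 4) k) ≠ 0 := by
  intro h
  have := congrArg (coeff (Finsupp.single (0 : Fin 4) 2)) h
  rw [map_add, coeff_X_pow, if_pos rfl, map_zero, X_pow_eq, X_pow_eq, monomial_mul_monomial, coeff_monomial,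
    if_neg] at this
  · simp at this
  · intro hh
    have h3 := DFunLike.congr_fun hh 3
    simp at h3

/-- `W₄ ∈ 𝔪²`. [OURS · L1 W4.3] -/
theorem two_le_order_witness4 : 2 ≤ (X 0 ^ 2 + X 3 ^ 3 * X 1 ^ 2 : MvPowerSeries (Fin 4) k).order := by
  refine le_trans ?_ MvPowerSeries.min_order_le_add
  refine le_min (MvPowerSeries.le_order_pow_of_constantCoeff_eq_zero 2 (constantCoeff_X (σ := Fin 4) (R := k) 0)) ?_
  refine le_trans ?_ MvPowerSeries.le_order_mul
  calc (2 : ℕ∞) ≤ 3 + 2 := by norm_num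
    _ ≤ _ := add_le_add (MvPowerSeries.le_order_pow_of_constantCoeff_eq_zero 3 (constantCoeff_X (σ := Fin 4) (R := k) 3))
        (MvPowerSeries.le_order_pow_of_constantCoeff_eq_zero 2 (constantCoeff_X (σ := Fin 4) (R := k) 1))

/-- Along an arc with `γ₀ = 0` and (`γ₁ = 0` or `γ₃ = 0`) — in particular along the three coordinate arcs `t·e₁`, `t·e₂`,
`t·e₃`, which lie in the singular locus `{x₀ = x₃ = 0} ∪ {x₀ = x₁ = 0}` of `W₄` — the germ `W₄` and all its partial derivatives
vanish. [OURS · L1 W4.3] -/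
theorem subst_arc_witness4_eq_zero {τ : Type} (γ : Fin 4 → MvPowerSeries τ k)
    (hγc : ∀ i, constantCoeff (γ i) = 0) (h0 : γ 0 = 0) (h13 : γ 1 = 0 ∨ γ 3 = 0) :
    subst γ (X 0 ^ 2 + X 3 ^ 3 * X 1 ^ 2 : MvPowerSeries (Fin 4) k) = 0 ∧
      ∀ m, subst γ (pd m (X 0 ^ 2 + X 3 ^ 3 * X 1 ^ 2 : MvPowerSeries (Fin 4) k)) = 0 := by
  classical
  have has : HasSubst γ := hasSubst_of_constantCoeff_zero hγc
  constructor
  · rw [← coe_substAlgHom has]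
    simp only [map_add, map_mul, map_pow, substAlgHom_X]
    rcases h13 with h | h <;> simp [h0, h]
  · intro m
    rw [map_add, pd_mul, pd_sq, pd_cube, pd_sq, ← coe_substAlgHom has]
    simp only [map_add, map_mul, map_pow, map_ofNat, substAlgHom_X]
    rcases h13 with h | h <;> simp [h0, h]

/-- Along a coordinate arc `t·e_a` with `a ≠ 0` the hypotheses of `subst_arc_witness4_eq_zero` hold. [OURS · L1 W4.3] -/
theorem single_arc_in_singular_locus (a : Fin 4) (ha : a ≠ 0) :
    (∀ i, PowerSeries.constantCoeff ((Pi.single a PowerSeries.X : Fin 4 → PowerSeries k) i) = 0) ∧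
      (Pi.single a PowerSeries.X : Fin 4 → PowerSeries k) 0 = 0 ∧
      ((Pi.single a PowerSeries.X : Fin 4 → PowerSeries k) 1 = 0 ∨
        (Pi.single a PowerSeries.X : Fin 4 → PowerSeries k) 3 = 0) := by
  refine ⟨fun i => ?_, Pi.single_eq_of_ne ha.symm _, ?_⟩
  · by_cases hi : i = a
    · subst hi; simp
    · simp [hi]
  · by_cases h1 : a = 1
    · subst h1; right; simp
    · left; exact Pi.single_eq_of_ne (Ne.symm h1) _

/-! ## §3 Non-containment (centres of codimension `≥ 2`) -/

/-- NON-CONTAINMENT.  If `θ(ψ) = X` (so the linear part of `ψ` is invertible) and at least TWO weights are positive (centre of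
codimension `≥ 2`), then one of the three transported coordinate arcs `ψ ∘ (t·e_a)`, `a ∈ {1,2,3}`, has a non-zero component of
positive weight: otherwise two rows of the linear part of `ψ` would both be multiples of `e₀ᵀ`. [OURS · L1 W4.3] -/
theorem exists_singleArc_not_in_centre4 {θ ψ : Fin 4 → MvPowerSeries (Fin 4) k}
    (hψ0 : ∀ i, constantCoeff (ψ i) = 0) (hcomp : ∀ s, subst ψ (θ s) = X s)
    (w : Fin 4 → ℕ) (i₁ i₂ : Fin 4) (h12 : i₁ ≠ i₂) (hw₁ : 0 < w i₁) (hw₂ : 0 < w i₂) :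
    ∃ a : Fin 4, a ≠ 0 ∧ ∃ i, 0 < w i ∧
      (subst (Pi.single a PowerSeries.X : Fin 4 → PowerSeries k) (ψ i) : PowerSeries k) ≠ 0 := by
  classical
  by_contra hcon
  push Not at hcon
  set L : Matrix (Fin 4) (Fin 4) k := Matrix.of fun m j => coeff (Finsupp.single j 1) (ψ m) with hL
  have hz : ∀ i, 0 < w i → ∀ j, j ≠ 0 → L i j = 0 := by
    intro i hwi j hj
    have h := congrArg (PowerSeries.coeff 1) (hcon j hj i hwi)
    rw [coeff_one_subst_single_X ψ j i, map_zero] at h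
    exact h
  have hmul := linMat_mul_of_comp_eq_X hψ0 hcomp
  have hdet : IsUnit L.det := by
    have h := congrArg Matrix.det hmul
    rw [Matrix.det_mul, Matrix.det_one] at h
    exact IsUnit.of_mul_eq_one _ (by rw [mul_comm]; exact h)
  exact not_two_rows_supported_single' hdet 0 i₁ i₂ h12 (hz i₁ hw₁) (hz i₂ hw₂)

/-! ## §4 Divisorial moves: `x_{i₀} ∤ W₄(θ)` -/

/-- For `W₄ = x₀² + x₃³x₁²` and ANY legal `θ` (zero constants, invertible linear part), `x_{i₀} ∤ W₄(θ)`: killing `x_{i₀}` in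
`θ` gives `ρ` with `ρ₀² + ρ₃³ρ₁² = 0`, at most one `ρ_s` of order `≥ 2` (two rows of the linear part cannot both be multiples of
`e_{i₀}ᵀ`), and the order equation `2n₀ = 3n₃ + 2n₁` has no such solution. [OURS · L1 W4.3] -/
theorem not_X_dvd_subst_witness4 {θ : Fin 4 → MvPowerSeries (Fin 4) k} (hθ0 : ∀ i, constantCoeff (θ i) = 0)
    (hdet : IsUnit (Matrix.det (Matrix.of fun i j => coeff (Finsupp.single j 1) (θ i)))) (i₀ : Fin 4) : ¬ X i₀ ∣ subst θ (X 0 ^ 2 + X 3 ^ 3 * X 1 ^ 2 : MvPowerSeries (Fin 4) k) := by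
  classical
  rintro ⟨h, hh⟩
  have hasθ := hasSubst_of_constantCoeff_zero hθ0
  set κ : Fin 4 → MvPowerSeries (Fin 4) k := fun l => if l = i₀ then (0 : MvPowerSeries (Fin 4) k) else X l with hκ
  have hκ0 : ∀ l, constantCoeff (κ l) = 0 := by
    intro l
    by_cases hl : l = i₀
    · simp [hκ, hl]
    · simp [hκ, hl, constantCoeff_X]
  have hasκ : HasSubst κ := hasSubst_of_constantCoeff_zero hκ0
  set ρ : Fin 4 → MvPowerSeries (Fin 4) k := fun s => subst κ (θ s) with hρ
  have hρc : ∀ s, constantCoeff (ρ s) = 0 := fun s => constantCoeff_subst_eq_zero hasκ hκ0 (hθ0 s)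
  have hasρ : HasSubst ρ := hasSubst_of_constantCoeff_zero hρc
  -- the relation `ρ₀² + ρ₃³ρ₁² = 0`
  have hrel : ρ 0 ^ 2 + ρ 3 ^ 3 * ρ 1 ^ 2 = 0 := by
    have h1 : subst κ (subst θ (X 0 ^ 2 + X 3 ^ 3 * X 1 ^ 2 : MvPowerSeries (Fin 4) k)) = 0 := by
      rw [hh, subst_mul hasκ, subst_X hasκ]
      simp [hκ]
    rw [subst_comp_subst_apply hasθ hasκ, subst_add hasρ, subst_mul hasρ, subst_pow hasρ, subst_pow hasρ, subst_pow hasρ,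
      subst_X hasρ, subst_X hasρ, subst_X hasρ] at h1
    exact h1
  -- exceptional rows: those whose linear part vanishes off column i₀
  set L : Matrix (Fin 4) (Fin 4) k := Matrix.of fun i j => coeff (Finsupp.single j 1) (θ i) with hL
  have hexc : ∀ s, 2 ≤ (ρ s).order ↔ ∀ j, j ≠ i₀ → L s j = 0 := by
    intro s
    rw [two_le_order_iff]
    constructor
    · rintro ⟨-, hl⟩ j hj
      have := hl j
      rw [hρ] at this
      simp only at this
      rw [coeff_single_subst_update_zero θ i₀ s j, if_neg hj] at this
      exact this
    · intro hz
      refine ⟨hρc s, fun j => ?_⟩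
      show coeff (Finsupp.single j 1) (subst κ (θ s)) = 0
      rw [hκ, coeff_single_subst_update_zero θ i₀ s j]
      split_ifs with hj
      · rfl
      · exact hz j hj
  have hone : ∀ s, 1 ≤ (ρ s).order := fun s => MvPowerSeries.one_le_order_iff_constCoeff_eq_zero.mpr (hρc s)
  have hatmost : ∀ s s', s ≠ s' → 2 ≤ (ρ s).order → 2 ≤ (ρ s').order → False := fun s s' hss hs hs' =>
    not_two_rows_supported_single' hdet i₀ s s' hss ((hexc s).mp hs) ((hexc s').mp hs')
  have hρ0 : ∀ s, ρ s = 0 → 2 ≤ (ρ s).order := fun s h => by rw [h, MvPowerSeries.order_zero]; exact le_top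
  -- the three constrained `ρ s` are non-zero
  have hne1 : ρ 1 ≠ 0 := by
    intro h1
    have : ρ 0 ^ 2 = 0 := by rw [h1] at hrel; simpa using hrel
    exact hatmost 0 1 (by decide) (hρ0 0 (pow_eq_zero_iff two_ne_zero |>.mp this)) (hρ0 1 h1)
  have hne3 : ρ 3 ≠ 0 := by
    intro h3
    have : ρ 0 ^ 2 = 0 := by rw [h3] at hrel; simpa using hrel
    exact hatmost 0 3 (by decide) (hρ0 0 (pow_eq_zero_iff two_ne_zero |>.mp this)) (hρ0 3 h3)
  have hne0 : ρ 0 ≠ 0 := by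
    intro h0
    have : ρ 3 ^ 3 * ρ 1 ^ 2 = 0 := by rw [h0] at hrel; simpa using hrel
    rcases mul_eq_zero.mp this with h | h
    · exact hne3 (pow_eq_zero_iff (by norm_num) |>.mp h)
    · exact hne1 (pow_eq_zero_iff two_ne_zero |>.mp h)
  -- finite orders
  obtain ⟨n0, hn0⟩ : ∃ m : ℕ, (ρ 0).order = m := ENat.ne_top_iff_exists.mp
    (MvPowerSeries.order_eq_top_iff.not.mpr hne0) |>.imp fun _ h => h.symm
  obtain ⟨n1, hn1⟩ : ∃ m : ℕ, (ρ 1).order = m := ENat.ne_top_iff_exists.mp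
    (MvPowerSeries.order_eq_top_iff.not.mpr hne1) |>.imp fun _ h => h.symm
  obtain ⟨n3, hn3⟩ : ∃ m : ℕ, (ρ 3).order = m := ENat.ne_top_iff_exists.mp
    (MvPowerSeries.order_eq_top_iff.not.mpr hne3) |>.imp fun _ h => h.symm
  -- the order equation `2 n0 = 3 n3 + 2 n1`
  have heq : 2 * n0 = 3 * n3 + 2 * n1 := by
    have h := congrArg MvPowerSeries.order (eq_neg_of_add_eq_zero_left hrel)
    rw [MvPowerSeries.order_neg, pow_two, pow_succ, pow_two, pow_two, MvPowerSeries.order_mul, MvPowerSeries.order_mul,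
      MvPowerSeries.order_mul, MvPowerSeries.order_mul, MvPowerSeries.order_mul, hn0, hn1, hn3] at h
    have h' : ((n0 + n0 : ℕ) : ℕ∞) = ((n3 + n3 + n3 + (n1 + n1) : ℕ) : ℕ∞) := by push_cast; exact h
    have := ENat.coe_inj.mp h'
    omega
  have h1' : 1 ≤ n0 ∧ 1 ≤ n1 ∧ 1 ≤ n3 := by
    refine ⟨?_, ?_, ?_⟩
    · have := hone 0; rw [hn0] at this; exact_mod_cast this
    · have := hone 1; rw [hn1] at this; exact_mod_cast this
    · have := hone 3; rw [hn3] at this; exact_mod_cast this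
  have htwo : ∀ s s' (ms ms' : ℕ), s ≠ s' → (ρ s).order = ms → (ρ s').order = ms' → 2 ≤ ms → 2 ≤ ms' → False := by
    intro s s' ms ms' hss hs hs' h2 h2'
    exact hatmost s s' hss (by rw [hs]; exact_mod_cast h2) (by rw [hs']; exact_mod_cast h2')
  rcases Nat.lt_or_ge n0 2 with h0 | h0
  · omega
  · have : n1 < 2 := by by_contra hh1; exact htwo 0 1 n0 n1 (by decide) hn0 hn1 h0 (by omega)
    have : n3 < 2 := by by_contra hh3; exact htwo 0 3 n0 n3 (by decide) hn0 hn3 h0 (by omega)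
    omega

/-! ## §5 Assembly -/

/-- **THE FOUR-VARIABLE WITNESS THEOREM (game form, every field).**  From `W₄(θ) = (x₀² + x₃³x₁²)(θ)`, for EVERY legal
coordinate change `θ` (zero constants, invertible linear part) and every weight vector with a positive entry, some exceptional
point `c` off the vertex of the cobordant blow-up has a SINGULAR `s`-saturated successor — in the literal form
`W₄(θ)(cruxChart_c) = sᵃ·g`, `s ∤ g`, `g ∈ 𝔪²` of `GradedGame.IsSuccessorAt` / `CobordantGame.IsSuccessor`.  Centres of
codimension `≥ 2`: a transported coordinate arc of the singular locus leaves the centre (`exists_singleArc_not_in_centre4`),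
then the ARC LEMMA; divisorial centres: `x_{i₀} ∤ W₄(θ)` (`not_X_dvd_subst_witness4`), so at `c = e_{i₀}` the successor is
`W₄(θ)(chart)` with exponent `0`, in `𝔪²`.  Four-variable transcription of `CobordantArc.witness_has_singular_successor`.
[OURS · L1 W4.3] -/
theorem subst_witness4_has_singular_successor (θ : Fin 4 → MvPowerSeries (Fin 4) k) (w : Fin 4 → ℕ)
    (hθ0 : ∀ i, constantCoeff (θ i) = 0) (hdet : IsUnit (Matrix.det (Matrix.of fun i j => coeff (Finsupp.single j 1) (θ i))))
    (hw : ∃ i, 0 < w i) :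
    ∃ c : Fin 4 → k, (∃ i, 0 < w i ∧ c i ≠ 0) ∧ ∃ (a : ℕ) (g : MvPowerSeries (Fin 5) k),
      subst (CobordantGame.cruxChart k w c) (subst θ (X 0 ^ 2 + X 3 ^ 3 * X 1 ^ 2 : MvPowerSeries (Fin 4) k)) = X 0 ^ a * g ∧
        ¬ X 0 ∣ g ∧ (constantCoeff g = 0 ∧ ∀ j, coeff (Finsupp.single j 1) g = 0) := by
  classical
  set f' := subst θ (X 0 ^ 2 + X 3 ^ 3 * X 1 ^ 2 : MvPowerSeries (Fin 4) k) with hf'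
  have hf'0 : f' ≠ 0 := subst_ne_zero_of_isUnit_det hθ0 hdet witness4_ne_zero
  have hf'2 : 2 ≤ f'.order := two_le_order_subst θ hθ0 _ two_le_order_witness4
  by_cases hbig : ∃ i₁ i₂ : Fin 4, i₁ ≠ i₂ ∧ 0 < w i₁ ∧ 0 < w i₂
  · -- centre of codimension ≥ 2: the arc lemma
    obtain ⟨i₁, i₂, h12, hw₁, hw₂⟩ := hbig
    obtain ⟨ψ, hψ0, hcomp, -⟩ := exists_comp_inverse hθ0 hdet
    obtain ⟨a, ha0, i, hwi, hne⟩ := exists_singleArc_not_in_centre4 hψ0 hcomp w i₁ i₂ h12 hw₁ hw₂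
    obtain ⟨hγc, hγ0, hγ13⟩ := single_arc_in_singular_locus (k := k) a ha0
    set γ : Fin 4 → PowerSeries k := Pi.single a PowerSeries.X with hγ
    set Γ : Fin 4 → PowerSeries k := fun i => subst γ (ψ i) with hΓ
    have hΓc : ∀ i, PowerSeries.constantCoeff (Γ i) = 0 := constantCoeff_subst_arc_zero hψ0 γ hγc
    have hS : ∃ i, 0 < w i ∧ Γ i ≠ 0 := ⟨i, hwi, hne⟩
    obtain ⟨hwγ, hwγpd⟩ := subst_arc_witness4_eq_zero (τ := Unit) γ hγc hγ0 hγ13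
    have hf : (subst Γ f' : PowerSeries k) = 0 := by
      rw [hΓ, hf', subst_arc_comp hθ0 hψ0 hcomp γ hγc, hwγ]
    have hpd : ∀ m, (subst Γ (pd m f') : PowerSeries k) = 0 := fun m => by
      rw [hΓ, hf']
      exact subst_arc_pd_comp hθ0 hψ0 hcomp γ hγc _ hwγpd m
    obtain ⟨c, hc, hoff, hall⟩ := exists_offVertex_singular_of_arc w f' Γ hΓc hS hf hpd
    have hF : subst (chart w c) f' ≠ 0 := subst_chart_ne_zero w c hc hf'0
    obtain ⟨e, g, hfac, hg⟩ := CobordantVertexChart.exists_eq_X_pow_mul_not_dvd hF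
    refine ⟨c, hoff, e, g, ?_, hg, hall e g hfac⟩
    rw [cruxChart_eq_chart_of_convention w c hc]
    exact hfac
  · -- divisorial move
    obtain ⟨i₀, hw₀⟩ := hw
    have hI : ∀ i, i ≠ i₀ → w i = 0 := by
      intro i hi
      by_contra hne
      exact hbig ⟨i, i₀, hi, Nat.pos_of_ne_zero hne, hw₀⟩
    set c : Fin 4 → k := Pi.single i₀ 1 with hcdef
    have hc : ∀ i, w i = 0 → c i = 0 := by
      intro i hi
      have : i ≠ i₀ := fun h => by subst h; omega
      simp [hcdef, this]
    refine ⟨c, ⟨i₀, hw₀, by simp [hcdef]⟩, 0, subst (chart w c) f', ?_, ?_, ?_⟩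
    · rw [cruxChart_eq_chart_of_convention w c hc, pow_zero, one_mul]
    · rw [hcdef, X_dvd_subst_chart_divisorial_iff w i₀ hw₀ hI]
      exact not_X_dvd_subst_witness4 hθ0 hdet i₀
    · exact (two_le_order_iff _).mp (two_le_order_subst (chart w c) (constantCoeff_chart w c hc) f' hf'2)

/-- **NO GRADED ONE-MOVE WIN FOR `W₄` IN ANY COORDINATES**: for every grading lattice `L ⊆ ℤ⁴` and every formal coordinate change
`Φ` (zero constants, invertible linear part), `¬ GradedWonBy 0 4 L (W₄(Φ))`.  (A graded move `(θ, w)` for `W₄(Φ)` is a legal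
move `(Φ ∘ θ, w)` for `W₄` — linear parts multiply, `linMat_comp` — with literally the same successors;
`subst_witness4_has_singular_successor`.) [OURS · L1 W4.3] -/
theorem not_gradedWonBy_zero_subst_witness4 (L : AddSubgroup (Fin 4 → ℤ)) (Φ : Fin 4 → MvPowerSeries (Fin 4) k)
    (hΦ0 : ∀ j, constantCoeff (Φ j) = 0) (hΦdet : IsUnit (linMat Φ).det) :
    ¬ GradedWonBy 0 4 L (subst Φ (X 0 ^ 2 + X 3 ^ 3 * X 1 ^ 2 : MvPowerSeries (Fin 4) k)) := by
  rw [gradedWonBy_zero_iff]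
  rintro ⟨θ, w, ⟨⟨hθ0, hdet, hw⟩, -⟩, hno⟩
  have hθs : HasSubst θ := hasSubst_of_constantCoeff_zero hθ0
  have hΦs : HasSubst Φ := hasSubst_of_constantCoeff_zero hΦ0
  set θ' : Fin 4 → MvPowerSeries (Fin 4) k := fun i => subst θ (Φ i) with hθ'
  have hθ'0 : ∀ i, constantCoeff (θ' i) = 0 := fun i => constantCoeff_subst_eq_zero hθs hθ0 (hΦ0 i)
  have hθ'det : IsUnit (Matrix.det (Matrix.of fun i j => coeff (Finsupp.single j 1) (θ' i))) := by
    change IsUnit (linMat θ').det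
    rw [hθ', linMat_comp θ Φ hθ0, Matrix.det_mul]
    exact hΦdet.mul hdet
  obtain ⟨c, hoff, a, g, hfac, hnd, hsing⟩ := subst_witness4_has_singular_successor θ' w hθ'0 hθ'det hw
  refine hno c a g ⟨hoff, ?_, hnd, hsing⟩
  rw [subst_comp_subst_apply hΦs hθs]
  exact hfac

end GradedGame

end Summit.ResolutionOfSingularities.ResolutionOfSingularities.Theorems
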